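import Summits.AtomisticToContinuum.FouriersLaw.Theorems.EmbeddedDrudeMourreDrudeDissolutionStubGramContinuityEigenPerturbation
import Literature.Analysis.OperatorTheory.GroundStateMarkovGap
import Literature.Analysis.OperatorTheory.L2KernelIntegralOperator
import HarnessLib

/-!
# Stub G `stub_gramContinuity`, tool 2: a continuous family of strictly positive kernels has a
locally uniform Jentzsch gap and a continuous top eigenvector (line `gram-pencil-harmonic-chaos`,
crux `EmbeddedDrudeMourre.DrudeDissolution`, item stmt-AtomisticToContinuum-12593; `--supports`
file, closes nothing)

WHAT. On a nonzero finite measure space `(X, μ)` let `K_ε`, `ε ∈ S ⊆ ℝ`, be jointly measurable,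
symmetric, strictly positive kernels bounded by `C`, continuous in `ε` pointwise. Then the transfer
operators `A_ε` (`(A_ε φ)(x) = ∫ K_ε(x,y) φ(y) dμ`) on the ONE real Hilbert space `L²(μ)` and their
Jentzsch unit top eigenvectors `φ_ε > 0` satisfy: `ε ↦ A_ε` is operator-norm continuous on `S`
(Hilbert–Schmidt bound + dominated convergence), `ε ↦ φ_ε` is norm continuous on `S`, and every
`ε₀ ∈ S` has a neighbourhood in `S` on which the gap of `A_ε` on `φ_ε^⊥` is `≤ ρ ‖A_ε‖` with ONE
`ρ < 1` (`kernel_family_local_gap`, registered sub-goal of stub G).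

WHY. Second step (after `top_eigenpair_perturbation`) towards the uniform-in-`ε` exponential mixing
and the continuity in `ε` of the thermal states along the coupling ray of stub G: compactness of
`[0, 1]` then gives a global `ρ < 1` (tool 3).

PROOF. `‖A_ε - A_ε'‖ ≤ ‖K_ε - K_ε'‖_{L²(μ⊗μ)}` (`integral_sq_integral_l2Kernel_mul_le`), which tends
to `0` by dominated convergence; the Jentzsch data of each `A_ε`
(`IsPositivityImproving.exists_spectralGap`); `⟪φ_ε₀, φ_ε⟫ > 0` for two a.e. positive functions
(`inner_pos`); and `top_eigenpair_perturbation`.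
-/

noncomputable section

open MeasureTheory Set Filter Function Topology
open scoped RealInnerProductSpace ENNReal
open Literature.Analysis.OperatorTheory

namespace Summit.AtomisticToContinuum.FouriersLaw.Theorems.DrudeDissolution.GramPencilHarmonicChaos

section KernelFamily

variable {X : Type} [MeasurableSpace X] {μ : Measure X} [IsFiniteMeasure μ]

/-- **Hilbert–Schmidt bound for the difference of two bounded-kernel operators**:
`‖A - A'‖ ≤ ‖K - K'‖_{L²(μ ⊗ μ)}`. [folklore] -/
theorem opNorm_sub_le_of_kernel {K K' : X → X → ℝ} {C : ℝ} (hK : StronglyMeasurable (uncurry K))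
    (hK' : StronglyMeasurable (uncurry K')) (hC : ∀ x y, ‖K x y‖ ≤ C) (hC' : ∀ x y, ‖K' x y‖ ≤ C)
    {A A' : Lp ℝ 2 μ →L[ℝ] Lp ℝ 2 μ}
    (hA : ∀ φ : Lp ℝ 2 μ, (A φ : X → ℝ) =ᵐ[μ] fun x => ∫ y, K x y * φ y ∂μ)
    (hA' : ∀ φ : Lp ℝ 2 μ, (A' φ : X → ℝ) =ᵐ[μ] fun x => ∫ y, K' x y * φ y ∂μ) :
    ‖A - A'‖ ≤ Real.sqrt (∫ z, (K z.1 z.2 - K' z.1 z.2) ^ 2 ∂(μ.prod μ)) := by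
  refine ContinuousLinearMap.opNorm_le_bound _ (Real.sqrt_nonneg _) fun φ => ?_
  have hΔm : StronglyMeasurable (uncurry fun x y => K x y - K' x y) := hK.sub hK'
  have hΔ : MemLp (uncurry fun x y => K x y - K' x y) 2 (μ.prod μ) := by
    refine MemLp.of_bound hΔm.aestronglyMeasurable (C + C) (ae_of_all _ fun z => ?_)
    exact (norm_sub_le _ _).trans (add_le_add (hC z.1 z.2) (hC' z.1 z.2))
  have h1 := integral_sq_integral_l2Kernel_mul_le hΔ φ
  have h2 : ‖(A - A') φ‖ ^ 2 = ∫ x, (∫ y, (K x y - K' x y) * φ y ∂μ) ^ 2 ∂μ := by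
    rw [← real_inner_self_eq_norm_sq, inner_eq_integral]
    refine integral_congr_ae ?_
    filter_upwards [hA φ, hA' φ, Lp.coeFn_sub (A φ) (A' φ)] with x hx hx' hs
    rw [sub_apply, hs, Pi.sub_apply, hx, hx',
      ← integral_sub (integrable_kernel_mul_coeFn hK hC φ x) (integrable_kernel_mul_coeFn hK' hC' φ x),
      ← sq]
    congr 1
    exact integral_congr_ae (ae_of_all _ fun y => by ring)
  have h3 : ‖(A - A') φ‖ ^ 2 ≤
      (Real.sqrt (∫ z, (K z.1 z.2 - K' z.1 z.2) ^ 2 ∂(μ.prod μ)) * ‖φ‖) ^ 2 := by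
    rw [mul_pow, Real.sq_sqrt (integral_nonneg fun z => sq_nonneg _), h2]
    exact h1
  exact (pow_le_pow_iff_left₀ (norm_nonneg _) (by positivity) two_ne_zero).1 h3

/-- **A pointwise continuous family of uniformly bounded kernels is Hilbert–Schmidt continuous**:
`∫ (K_ε - K_ε₀)² d(μ ⊗ μ) → 0` as `ε → ε₀` within `S` (dominated convergence). [folklore] -/
theorem tendsto_integral_kernel_sub_sq {S : Set ℝ} {K : ℝ → X → X → ℝ} {C : ℝ}
    (hKm : ∀ ε ∈ S, StronglyMeasurable (uncurry (K ε))) (hKC : ∀ ε ∈ S, ∀ x y, ‖K ε x y‖ ≤ C)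
    (hKc : ∀ x y, ContinuousOn (fun ε => K ε x y) S) {ε₀ : ℝ} (hε₀ : ε₀ ∈ S) :
    Tendsto (fun ε => ∫ z, (K ε z.1 z.2 - K ε₀ z.1 z.2) ^ 2 ∂(μ.prod μ)) (𝓝[S] ε₀) (𝓝 0) := by
  have hlim : Tendsto (fun ε => ∫ z, (K ε z.1 z.2 - K ε₀ z.1 z.2) ^ 2 ∂(μ.prod μ)) (𝓝[S] ε₀)
      (𝓝 (∫ _z : X × X, (0 : ℝ) ∂(μ.prod μ))) := by
    refine tendsto_integral_filter_of_dominated_convergence (fun _ => (C + C) ^ 2) ?_ ?_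
      (integrable_const _) (ae_of_all _ fun z => ?_)
    · filter_upwards [self_mem_nhdsWithin] with ε hε
      exact (((hKm ε hε).sub (hKm ε₀ hε₀)).measurable.pow_const 2).aestronglyMeasurable
    · filter_upwards [self_mem_nhdsWithin] with ε hε
      refine ae_of_all _ fun z => ?_
      have h1 := hKC ε hε z.1 z.2
      have h2 := hKC ε₀ hε₀ z.1 z.2
      rw [Real.norm_eq_abs] at h1 h2
      have h3 : |K ε z.1 z.2 - K ε₀ z.1 z.2| ≤ C + C := (abs_sub _ _).trans (add_le_add h1 h2)
      rw [Real.norm_eq_abs, abs_pow]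
      exact pow_le_pow_left₀ (abs_nonneg _) h3 2
    · have h := ((hKc z.1 z.2).continuousWithinAt hε₀).tendsto
      have h2 : Tendsto (fun ε => (K ε z.1 z.2 - K ε₀ z.1 z.2) ^ 2) (𝓝[S] ε₀)
          (𝓝 ((K ε₀ z.1 z.2 - K ε₀ z.1 z.2) ^ 2)) := (h.sub tendsto_const_nhds).pow 2
      rwa [sub_self, zero_pow two_ne_zero] at h2
  rwa [integral_zero] at hlim

/-- **A continuous family of strictly positive kernels: operators, Jentzsch data, norm continuity,
eigenvector continuity and a locally uniform gap** (named-hypotheses form of the registered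
`kernel_family_local_gap`). [folklore] -/
theorem kernel_family_local_gap' (hμ : μ ≠ 0) {S : Set ℝ} {K : ℝ → X → X → ℝ} {C : ℝ}
    (hKm : ∀ ε ∈ S, StronglyMeasurable (uncurry (K ε)))
    (hKC : ∀ ε ∈ S, ∀ x y, ‖K ε x y‖ ≤ C) (hKs : ∀ ε ∈ S, ∀ x y, K ε x y = K ε y x)
    (hKp : ∀ ε ∈ S, ∀ x y, 0 < K ε x y) (hKc : ∀ x y, ContinuousOn (fun ε => K ε x y) S) :
    ∃ (A : ℝ → (Lp ℝ 2 μ →L[ℝ] Lp ℝ 2 μ)) (φ₀ : ℝ → Lp ℝ 2 μ),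
      (∀ ε ∈ S, (∀ φ : Lp ℝ 2 μ, (A ε φ : X → ℝ) =ᵐ[μ] fun x => ∫ y, K ε x y * φ y ∂μ) ∧
        IsSelfAdjoint (A ε) ∧ A ε ≠ 0 ∧ ‖φ₀ ε‖ = 1 ∧ IsStrictlyPositiveFun (φ₀ ε) ∧
        A ε (φ₀ ε) = ‖A ε‖ • φ₀ ε ∧ (∀ η, A ε η = ‖A ε‖ • η → η = ⟪φ₀ ε, η⟫ • φ₀ ε)) ∧
      (∀ ε₀ ∈ S, Tendsto (fun ε => ‖A ε - A ε₀‖) (𝓝[S] ε₀) (𝓝 0)) ∧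
      (∀ ε₀ ∈ S, Tendsto (fun ε => ‖φ₀ ε - φ₀ ε₀‖) (𝓝[S] ε₀) (𝓝 0)) ∧
      ∀ ε₀ ∈ S, ∃ ρ : ℝ, ρ < 1 ∧ ∀ᶠ ε in 𝓝[S] ε₀, ∀ w : Lp ℝ 2 μ, ⟪φ₀ ε, w⟫ = 0 →
        ‖A ε w‖ ≤ ρ * ‖A ε‖ * ‖w‖ := by
  classical
  -- Step 0: the operators and their Jentzsch data
  have hex : ∀ ε, ∃ (A : Lp ℝ 2 μ →L[ℝ] Lp ℝ 2 μ) (φ₀ : Lp ℝ 2 μ) (θ : ℝ), ε ∈ S →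
      (∀ φ : Lp ℝ 2 μ, (A φ : X → ℝ) =ᵐ[μ] fun x => ∫ y, K ε x y * φ y ∂μ) ∧ IsSelfAdjoint A ∧
      A ≠ 0 ∧ ‖φ₀‖ = 1 ∧ IsStrictlyPositiveFun φ₀ ∧ A φ₀ = ‖A‖ • φ₀ ∧
      (∀ η, A η = ‖A‖ • η → η = ⟪φ₀, η⟫ • φ₀) ∧
      0 ≤ θ ∧ θ < ‖A‖ ∧ ∀ w, ⟪φ₀, w⟫ = 0 → ‖A w‖ ≤ θ * ‖w‖ := by
    intro ε
    by_cases hε : ε ∈ S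
    · obtain ⟨A, hA, hsa, hc, himp, h0⟩ :=
        exists_transferOperator (μ := μ) (hKm ε hε) (hKC ε hε) (hKs ε hε) (hKp ε hε) hμ
      obtain ⟨φ₀, h1, h2, h3, h4, θ, h5, h6, h7⟩ := himp.exists_spectralGap hsa hc h0
      exact ⟨A, φ₀, θ, fun _ => ⟨hA, hsa, h0, h1, h2, h3, h4, h5, h6, h7⟩⟩
    · exact ⟨0, 0, 0, fun h => absurd h hε⟩
  choose A φ₀ θ hspec using hex
  -- Step 1: norm continuity
  have hd : ∀ ε₀ ∈ S, Tendsto (fun ε => ‖A ε - A ε₀‖) (𝓝[S] ε₀) (𝓝 0) := by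
    intro ε₀ hε₀
    have h1 := (tendsto_integral_kernel_sub_sq (μ := μ) hKm hKC hKc hε₀).sqrt
    rw [Real.sqrt_zero] at h1
    refine squeeze_zero' (Eventually.of_forall fun ε => norm_nonneg _) ?_ h1
    filter_upwards [self_mem_nhdsWithin] with ε hε
    exact opNorm_sub_le_of_kernel (hKm ε hε) (hKm ε₀ hε₀) (hKC ε hε) (hKC ε₀ hε₀) (hspec ε hε).1
      (hspec ε₀ hε₀).1
  -- Step 2: the perturbation lemma around each `ε₀ ∈ S`
  have hpert : ∀ ε₀ ∈ S, ∀ ε ∈ S, 2 * ‖A ε₀ - A ε‖ ≤ ‖A ε₀‖ - θ ε₀ →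
      ‖φ₀ ε - φ₀ ε₀‖ ≤ 4 * ‖A ε₀ - A ε‖ / (‖A ε₀‖ - θ ε₀) ∧
        ∀ w : Lp ℝ 2 μ, ⟪φ₀ ε, w⟫ = 0 → ‖A ε w‖ ≤ (θ ε₀ + ‖A ε₀ - A ε‖ +
          ‖A ε₀‖ * (4 * ‖A ε₀ - A ε‖ / (‖A ε₀‖ - θ ε₀))) * ‖w‖ := by
    intro ε₀ hε₀ ε hε hsmall
    obtain ⟨-, hsa₀, -, hn₀, hp₀, he₀, -, hθ0, hθlt, hgap₀⟩ := hspec ε₀ hε₀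
    obtain ⟨-, -, -, hn, hp, he, -, -, -, -⟩ := hspec ε hε
    have hip : 0 ≤ ⟪φ₀ ε₀, φ₀ ε⟫ := (inner_pos (hp₀.isPositiveFun hμ) hp).le
    exact top_eigenpair_perturbation' hsa₀ hn₀ hn he₀ he hθ0 hθlt hgap₀ hip hsmall
  refine ⟨A, φ₀, fun ε hε => ?_, hd, fun ε₀ hε₀ => ?_, fun ε₀ hε₀ => ?_⟩
  · obtain ⟨h1, h2, h3, h4, h5, h6, h7, -, -, -⟩ := hspec ε hε
    exact ⟨h1, h2, h3, h4, h5, h6, h7⟩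
  · -- eigenvector continuity
    obtain ⟨-, -, -, -, -, -, -, hθ0, hθlt, -⟩ := hspec ε₀ hε₀
    have hg₀ : 0 < ‖A ε₀‖ - θ ε₀ := sub_pos.2 hθlt
    have hd' : Tendsto (fun ε => ‖A ε₀ - A ε‖) (𝓝[S] ε₀) (𝓝 0) := by
      simpa only [norm_sub_rev] using hd ε₀ hε₀
    have hsmall : ∀ᶠ ε in 𝓝[S] ε₀, 2 * ‖A ε₀ - A ε‖ ≤ ‖A ε₀‖ - θ ε₀ := by
      have h2 : Tendsto (fun ε => 2 * ‖A ε₀ - A ε‖) (𝓝[S] ε₀) (𝓝 (2 * 0)) :=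
        hd'.const_mul 2
      rw [mul_zero] at h2
      exact (tendsto_order.1 h2).2 _ hg₀ |>.mono fun ε hε => hε.le
    have hbound : Tendsto (fun ε => 4 * ‖A ε₀ - A ε‖ / (‖A ε₀‖ - θ ε₀)) (𝓝[S] ε₀) (𝓝 0) := by
      have := (hd'.const_mul 4).div_const (‖A ε₀‖ - θ ε₀)
      rwa [mul_zero, zero_div] at this
    refine squeeze_zero' (Eventually.of_forall fun ε => norm_nonneg _) ?_ hbound
    filter_upwards [hsmall, self_mem_nhdsWithin] with ε hε hεS
    exact (hpert ε₀ hε₀ ε hεS hε).1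
  · -- the locally uniform gap
    obtain ⟨-, -, h0, -, -, -, -, hθ0, hθlt, -⟩ := hspec ε₀ hε₀
    set lam₀ : ℝ := ‖A ε₀‖ with hlam₀
    set θ₀ : ℝ := θ ε₀ with hθ₀
    set g₀ : ℝ := lam₀ - θ₀ with hg₀_def
    have hg₀ : 0 < g₀ := sub_pos.2 hθlt
    have hlam₀pos : 0 < lam₀ := norm_pos_iff.2 h0
    set ρ : ℝ := (lam₀ + θ₀) / (2 * lam₀) with hρ_def
    have hρ1 : ρ < 1 := by
      rw [hρ_def, div_lt_one (by positivity)]; linarith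
    have hρ0 : 0 ≤ ρ := by positivity
    set δ₀ : ℝ := (g₀ / 2) / (1 + 4 * lam₀ / g₀ + ρ) with hδ₀_def
    have hden : 0 < 1 + 4 * lam₀ / g₀ + ρ := by positivity
    have hδ₀ : 0 < δ₀ := by positivity
    have hδ₀le : 2 * δ₀ ≤ g₀ := by
      have h1 : (1 : ℝ) ≤ 1 + 4 * lam₀ / g₀ + ρ := by
        have : 0 ≤ 4 * lam₀ / g₀ := by positivity
        linarith
      have h2 : δ₀ ≤ g₀ / 2 := div_le_self (by positivity) h1
      linarith
    have hd' : Tendsto (fun ε => ‖A ε₀ - A ε‖) (𝓝[S] ε₀) (𝓝 0) := by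
      simpa only [norm_sub_rev] using hd ε₀ hε₀
    have hsmall : ∀ᶠ ε in 𝓝[S] ε₀, ‖A ε₀ - A ε‖ ≤ δ₀ :=
      (tendsto_order.1 hd').2 _ hδ₀ |>.mono fun ε hε => hε.le
    refine ⟨ρ, hρ1, ?_⟩
    filter_upwards [hsmall, self_mem_nhdsWithin] with ε hε hεS
    intro w hw
    set d : ℝ := ‖A ε₀ - A ε‖ with hd_def
    have hd0 : 0 ≤ d := norm_nonneg _
    have h2d : 2 * d ≤ lam₀ - θ₀ := by linarith
    have hgap := (hpert ε₀ hε₀ ε hεS h2d).2 w hw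
    have hkey : d * (1 + 4 * lam₀ / g₀ + ρ) ≤ g₀ / 2 := by
      calc d * (1 + 4 * lam₀ / g₀ + ρ) ≤ δ₀ * (1 + 4 * lam₀ / g₀ + ρ) :=
            mul_le_mul_of_nonneg_right hε hden.le
        _ = g₀ / 2 := by rw [hδ₀_def]; field_simp
    have hkey' : d + lam₀ * (4 * d / g₀) + ρ * d ≤ g₀ / 2 := by
      have : d + lam₀ * (4 * d / g₀) + ρ * d = d * (1 + 4 * lam₀ / g₀ + ρ) := by ring
      rw [this]; exact hkey
    have hρlam : ρ * lam₀ = (lam₀ + θ₀) / 2 := by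
      rw [hρ_def]; field_simp
    have hlamε : lam₀ - d ≤ ‖A ε‖ := by
      have := norm_sub_norm_le (A ε₀) (A ε); linarith
    have hw0 : 0 ≤ ‖w‖ := norm_nonneg _
    calc ‖A ε w‖ ≤ (θ₀ + d + lam₀ * (4 * d / (lam₀ - θ₀))) * ‖w‖ := hgap
      _ ≤ ρ * (lam₀ - d) * ‖w‖ := by
          refine mul_le_mul_of_nonneg_right ?_ hw0
          rw [← hg₀_def]
          linarith
      _ ≤ ρ * ‖A ε‖ * ‖w‖ := by gcongr

/-- **A continuous family of strictly positive kernels has a locally uniform Jentzsch gap and a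
continuous top eigenvector** (registered sub-goal of stub G; see `kernel_family_local_gap'`).
[folklore] -/
theorem kernel_family_local_gap : ∀ {X : Type} [MeasurableSpace X] (μ : MeasureTheory.Measure X)
    [MeasureTheory.IsFiniteMeasure μ], μ ≠ 0 → ∀ (S : Set ℝ) (K : ℝ → X → X → ℝ) (C : ℝ),
    (∀ ε ∈ S, MeasureTheory.StronglyMeasurable (Function.uncurry (K ε))) →
    (∀ ε ∈ S, ∀ x y, ‖K ε x y‖ ≤ C) → (∀ ε ∈ S, ∀ x y, K ε x y = K ε y x) →
    (∀ ε ∈ S, ∀ x y, 0 < K ε x y) → (∀ x y, ContinuousOn (fun ε => K ε x y) S) →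
    ∃ (A : ℝ → (MeasureTheory.Lp ℝ 2 μ →L[ℝ] MeasureTheory.Lp ℝ 2 μ))
      (φ₀ : ℝ → MeasureTheory.Lp ℝ 2 μ),
      (∀ ε ∈ S, (∀ φ : MeasureTheory.Lp ℝ 2 μ,
          (A ε φ : X → ℝ) =ᵐ[μ] fun x => ∫ y, K ε x y * φ y ∂μ) ∧
        IsSelfAdjoint (A ε) ∧ A ε ≠ 0 ∧ ‖φ₀ ε‖ = 1 ∧
        Literature.Analysis.OperatorTheory.IsStrictlyPositiveFun (φ₀ ε) ∧
        A ε (φ₀ ε) = ‖A ε‖ • φ₀ ε ∧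
        (∀ η, A ε η = ‖A ε‖ • η → η = inner ℝ (φ₀ ε) η • φ₀ ε)) ∧
      (∀ ε₀ ∈ S, Filter.Tendsto (fun ε => ‖A ε - A ε₀‖) (nhdsWithin ε₀ S) (nhds 0)) ∧
      (∀ ε₀ ∈ S, Filter.Tendsto (fun ε => ‖φ₀ ε - φ₀ ε₀‖) (nhdsWithin ε₀ S) (nhds 0)) ∧
      ∀ ε₀ ∈ S, ∃ ρ : ℝ, ρ < 1 ∧ ∀ᶠ ε in nhdsWithin ε₀ S, ∀ w : MeasureTheory.Lp ℝ 2 μ,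
        inner ℝ (φ₀ ε) w = 0 → ‖A ε w‖ ≤ ρ * ‖A ε‖ * ‖w‖ :=
  fun _ _ hμ _ _ _ hKm hKC hKs hKp hKc => kernel_family_local_gap' hμ hKm hKC hKs hKp hKc

end KernelFamily

end Summit.AtomisticToContinuum.FouriersLaw.Theorems.DrudeDissolution.GramPencilHarmonicChaos

end
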